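import Summits.HodgeConjecture.HodgeConjecture.Theorems.HeckePrymWeilHeckePrymAnchorsOfCMAnchoredFamily
import Literature.AlgebraicGeometry.HodgeTheory.WeilTypeAbelianVariety
import Literature.AlgebraicGeometry.HodgeTheory.WeilFamilyPeriodConstructionAtWeilType
import HarnessLib

/-!
# `HeckePrymAnchors` from Deligne's period construction AT WEIL-TYPE POINTS (item stmt-HodgeConjecture-14496, route HeckePrymWeil)

Helper for the crux `HeckePrymAnchors` (line `Sketch`), count-neutral: three theorems (rev. 2: + the by-name
sequel, CONDITIONAL on the named fact), no definition, no `sorry`. Written by the computation cell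
`pub-hsemireg` (track «S4-PUSH» (iii), seat s4-bridge-2, gen 33; words gen 34–35; rev. 2 drafted by gen 34–35), whose
lane named the residual «(J1) = Deligne's period-construction package» in its PRINTED scope.

The landed Riemann-free closure of this crux (`heckePrymAnchors_of_periodConstruction`,
`Theorems/HeckePrymWeilHeckePrymAnchorsOfPeriodConstructionCrux`; sandwich certificate
`cmAnchoredFamily_of_periodConstruction`, `Theorems/HeckePrymWeilHeckePrymAnchorsOfCMAnchoredFamily`) takes
the UNRESTRICTED period-construction package [U]: Deligne's level-`n'` family with period surjectivity is
asked through EVERY polarized `(P, ψ₀)` with `ψ₀ ≫ ψ₀ = -d`, whatever the signature of the `K`-action on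
`H^{1,0}`. Deligne prints the construction in the proof of [Deligne1982HodgeCycles] Thm. 4.8 — stated under
hypothesis (b) = a SPLIT `E`-Hermitian form `φ` on `H₁(A, ℚ)` with `Tr_{E/ℚ}(fφ)` a Riemann form, which forces
the Weil signature `(n, n)` of Prop. 4.4 («(b) implies that A satisfies the equivalent statements of (4.4)»,
Milne's TeXed ed., p. 32), not conversely; the family `X⁺`, `B`, `Γ∖B → Γ∖X⁺` is built from the
signature-`(n, n)` Hermitian data `(H, ψ, ν)` alone (the split form re-enters only to place `A₀ ⊗_ℚ E` in the
family, p. 34 — a step the package does not use), and van Geemen 4.9, 5.3–5.5, 5.8–5.11 re-print it for every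
discriminant — and the crux
only ever applies the package at a WEIL-TYPE point: [U_alg] quantifies
over BALANCED `(X, Φ)` (`dim (V_{i√p} ∩ H^{1,0}) = k`), which is exactly van Geemen's condition 4.9,
`IsWeilType X Φ k p`. This file records that the WEIL-TYPE package suffices:

* `cmAnchoredFamily_of_periodConstructionAtWeilType` — [U at Weil-type points] ⟹ [U_alg]: the proof of
  `cmAnchoredFamily_of_periodConstruction` verbatim, with the (there unused) balancedness hypothesis of
  [U_alg] now feeding the package's `IsWeilType` premise (`⟨hk, hp0, hX, hΦn, hbal⟩`), and the package's
  extra polarization datum `a'` with its clause (6) dropped by the pattern;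
* `heckePrymAnchors_of_periodConstructionAtWeilType` — **[U at Weil-type points] ⟹ `HeckePrymAnchors`**
  (composition with the landed `heckePrymAnchors_of_cmAnchoredFamily`; the algebraic-anchor form in between
  is `kActionAlg_of_cmAnchoredFamily ∘ cmAnchoredFamily_of_periodConstructionAtWeilType`, not restated);
* `heckePrymAnchors_of_deligne1982_weilFamily_periodConstructionAtWeilType` (rev. 2, appended) — the same from the
  NAMED fact `Literature.AlgebraicGeometry.HodgeTheory.deligne1982_weilFamily_periodConstructionAtWeilType`
  (`HodgeTheory/WeilFamilyPeriodConstructionAtWeilType`, now in the tree), by `exact`: the crux is CONDITIONAL on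
  exactly that one printed, UNPROVED fact.

The hypothesis is displayed VERBATIM and is TOKEN-FOR-TOKEN (whitespace-normalised) the body of the cell's
named-fact candidate
`Literature.AlgebraicGeometry.HodgeTheory.deligne1982_weilFamily_periodConstructionAtWeilType` (target
`Literature/AlgebraicGeometry/HodgeTheory/WeilFamilyPeriodConstructionAtWeilType.lean`, not yet in the tree at
the time of writing) = the hypothesis `h` of
`Summit.Ventures.HSemireg.weilFamilyReach_similar_of_levelConstructions_of_periodSurjective` and of
`Literature.AlgebraicGeometry.HodgeTheory.deligne1982_weilFamily_levelStructure_of_periodConstructionAtWeilType`: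
clauses (1) smooth projective family `f : 𝒳 → S` of relative dimension `2n` over an irreducible smooth
quasi-projective `S`, closed `S`-immersion into `ℙᴺ × S`, `e' : P ≅ 𝒳_{s₀}`; (2) a global endomorphism `g`
restricting to `ψ₀` and to `Ψ_s` (`Ψ_s² = -d`) on abelian fibre charts; (4ℓ) an integral basis of
`H¹(𝒳_{s₀}; ℂ)` with integral fibre endomorphism and every monodromy `≡ 1 (mod n')`, `n' ≥ 3`; (5U) period
surjectivity onto `X⁺` of the rational Weil datum of `(P, ψ₀, h_K)`; (6) one rational polarization class on
`ℙᴺ` restricting to `h_K` at `s₀` — asked only when `(P, ψ₀)` is of Weil type `(n, n)`. So once that name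
lands, `HeckePrymAnchors` follows from it BY NAME in one line (sequel leaf), and the residual of this crux is
the PRINTED scope of Deligne's construction. HONEST FRAMING: nothing here bears on any open case of the Hodge
conjecture; HC / HC_CM / HC_AV are NOT proved; the package stays an UNPROVED hypothesis; no object of the
cell `pub-hsemireg` is certified.
-/

noncomputable section

-- every declaration of this problem lives in `Summit.HodgeConjecture.HodgeConjecture.…` (summit = sub-problem)
set_option linter.dupNamespace false

open CategoryTheory AlgebraicGeometry Limits MonoidalCategory CartesianMonoidalCategory
open Literature.AlgebraicTopology.SingularHomology
open scoped TensorProduct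

namespace Summit.HodgeConjecture.HodgeConjecture.Theorems.HeckePrymWeilLine

open Literature.AlgebraicGeometry Literature.AlgebraicGeometry.Motives Literature.AlgebraicGeometry.HodgeTheory
open Summit.HodgeConjecture.HodgeConjecture.Theses.HeckePrymWeil

/-- **Deligne's period construction AT WEIL-TYPE POINTS delivers a CM-anchored algebraic Weil family**:
[U at Weil-type points] ⟹ [U_alg] (the hypothesis of the landed `heckePrymAnchors_of_cmAnchoredFamily`).
The package — Deligne's level-`n'` algebraic family `Γ∖B → Γ∖X⁺` through `(P, ψ₀, h_K)` with its global
`√-d`, abelian fibre charts, integral level structure at the base point, period surjectivity onto `X⁺` and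
one polarization class ([Deligne1982HodgeCycles], proof of Thm. 4.8; Baily–Borel and Borel;
[MumfordFogartyKirwan1994, Thm. 7.9–7.10]) — is asked ONLY for `(P, ψ₀)` of Weil type `(n, n)`
(`IsWeilType`, van Geemen 4.9 = Deligne 1982, Prop. 4.4), the scope in which Deligne prints it (proof of
Thm. 4.8, whose hypothesis (b) — a SPLIT `E`-Hermitian form carrying a Riemann form — forces the signature of
Prop. 4.4; the family itself is built from the signature-`(n, n)` Hermitian data alone) and in which van
Geemen 5.3–5.5, 5.8–5.11 re-print it for every discriminant. Given a BALANCED `(X, Φ)` (`Φ ≫ Φ = -p`,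
`dim X = 2k`, `dim (V_{i√p} ∩ H^{1,0}) = k` — precisely `IsWeilType X Φ k p`), the package applies at
`P = X`; the fibre over the rational diagonal CM point `J_R` of `X⁺(D_X)`
(`WeilDatum.exists_isWeilComplexStructure_rational`, period surjectivity at that ONE point) carries the
rational `Ψ^*`-linear CM projector of `cm_projector_of_periodPoint`. The proof is that of
`cmAnchoredFamily_of_periodConstruction` verbatim, except that the balancedness hypothesis (unused there)
now discharges the package's Weil-type premise and the extra datum `a'` / clause (6) are discarded.
[cite: Deligne1982HodgeCycles, §4 Prop. 4.4 and proof of Thm. 4.8 (Milne's TeXed ed., rev. 2018, pp. 32–34; LNM 900 §4)]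
[cite: vanGeemen1994HodgeAV, 4.9, 5.3–5.5 and 5.8–5.11] [cite: MumfordFogartyKirwan1994, Thm. 7.9–7.10] -/
theorem cmAnchoredFamily_of_periodConstructionAtWeilType :
    (∀ (n d : ℕ), 1 ≤ n → 1 ≤ d →
        ∀ (P : AbelianVariety ℂ) (ψ₀ : P ⟶ P) (e : ProjectiveEmbedding P.X)
          (a : complexBetti (projectiveSpace e.n ℂ) 2),
          P.dim = 2 * n → ψ₀ ≫ ψ₀ = -((d : ℤ) • 𝟙 P) → ∀ (ha : IsRationalClass a) (ha0 : a ≠ 0),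
          IsWeilType P ψ₀ n d →
          ∃ (𝒳 S : SchemeOver ℂ) (f : 𝒳 ⟶ S) (g : 𝒳 ⟶ 𝒳) (s₀ : ComplexPoints S)
            (e' : P.X ≅ fiberOver f s₀)
            (Y : ComplexPoints S → AbelianVariety ℂ) (Ψ : ∀ s, Y s ⟶ Y s)
            (ε : ∀ s, (Y s).X ≅ fiberOver f s) (N : ℕ)
            (ι : 𝒳 ⟶ CategoryTheory.MonoidalCategoryStruct.tensorObj (projectiveSpace N ℂ) S)
            (a' : complexBetti (projectiveSpace N ℂ) 2),
            IsSmoothProjectiveFamily f (2 * n) ∧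
            AlgebraicGeometry.IsClosedImmersion ι.left ∧
            ι ≫ CategoryTheory.CartesianMonoidalCategory.snd (projectiveSpace N ℂ) S = f ∧
            IrreducibleSpace S.left ∧ AlgebraicGeometry.Smooth S.hom ∧ IsQuasiProjectiveOver S ∧
            g ≫ f = f ∧
            (e'.hom ≫ fiberι f s₀) ≫ g = ψ₀.hom.hom.hom ≫ (e'.hom ≫ fiberι f s₀) ∧
            (∀ s, (Y s).dim = 2 * n ∧ Ψ s ≫ Ψ s = -((d : ℤ) • 𝟙 (Y s)) ∧
              ((ε s).hom ≫ fiberι f s) ≫ g = (Ψ s).hom.hom.hom ≫ ((ε s).hom ≫ fiberι f s)) ∧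
            (∃ (ιb : Type) (_ : Fintype ιb) (_ : DecidableEq ιb)
                (b : Module.Basis ιb ℂ (complexBetti (fiberOver f s₀) 1)) (Jℤ : Matrix ιb ιb ℤ)
                (n' : ℕ),
              3 ≤ n' ∧
              (∀ g₀ : fiberOver f s₀ ⟶ fiberOver f s₀, g₀ ≫ fiberι f s₀ = fiberι f s₀ ≫ g →
                LinearMap.toMatrix b b (complexBetti.map g₀ 1).hom = Jℤ.map (Int.castRingHom ℂ)) ∧
              ∀ (hU : IsCohomologicallyLocallyTrivialOn f (Set.univ : Set (ComplexPoints S)))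
                (γ : Path.Homotopic.Quotient
                  (⟨s₀, Set.mem_univ s₀⟩ : (Set.univ : Set (ComplexPoints S))) ⟨s₀, Set.mem_univ s₀⟩),
                ∃ Dℤ : Matrix ιb ιb ℤ,
                  LinearMap.toMatrix b b (transportLinear f 1 hU γ :) =
                    (1 + (n' : ℤ) • Dℤ).map (Int.castRingHom ℂ)) ∧
            (∃ (m : ℕ) (hm : 1 ≤ m) (hPm : P.dim = m + 1) (hd : 0 < d) (hψ : ψ₀ ≫ ψ₀ = -(d • 𝟙 P))
                (ω : complexBetti P.X (2 + 2 * m)) (hω : IsRationalClass ω) (hω0 : ω ≠ 0),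
              ∀ (J : (weilDatumOfKsymm hm hPm hd hψ e ha ha0 hω hω0).Cx →ₗ[ℂ]
                  (weilDatumOfKsymm hm hPm hd hψ e ha ha0 hω hω0).Cx)
                (hW : Motives.IsWeilComplexStructure
                  (weilDatumOfKsymm hm hPm hd hψ e ha ha0 hω hω0).hForm J),
                ∃ (s : ComplexPoints S) (β : bettiCohomology P.X 1 ≃ₗ[ℚ] bettiCohomology (Y s).X 1),
                  (∀ x, β (bettiCohomology.map ψ₀.hom.hom.hom 1 x) =
                    bettiCohomology.map (Ψ s).hom.hom.hom 1 (β x)) ∧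
                  ∀ x ∈ ((weilDatumOfKsymm hm hPm hd hψ e ha ha0 hω hω0).hodgeStructure J hW.sq).piece 1 0,
                    IsOfHodgeType (2 * n) (Y s).X 1 1 0
                      (Motives.ofRatClassBaseChange (ComplexPoints (Y s).X) 1
                        (β.toLinearMap.baseChange ℂ x))) ∧
            IsRationalClass a' ∧
            complexBetti.map e'.hom 2 (complexBetti.map (fiberι f s₀) 2
              (complexBetti.map
                (ι ≫ CategoryTheory.CartesianMonoidalCategory.fst (projectiveSpace N ℂ) S) 2 a')) =
              (d : ℂ) • complexBetti.map e.ι 2 a +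
                complexBetti.map ψ₀.hom.hom.hom 2 (complexBetti.map e.ι 2 a)) →
    (∀ p : ℕ, p.Prime → p % 4 = 3 → 7 ≤ p → ∀ (k : ℕ), 1 ≤ k → ∀ (X : AbelianVariety ℂ) (Φ : X ⟶ X) (hX : X.dim = 2 * k), Φ ≫ Φ = -((p : ℤ) • 𝟙 X) → Module.finrank ℂ ↥(Module.End.eigenspace (complexBetti.map Φ.hom.hom.hom 1).hom (Complex.I * (Real.sqrt p : ℂ)) ⊓ hodgeOneZero (Motives.isSmoothProjective_of_dim_eq' hX)) = k → ∃ (𝒳 S : SchemeOver ℂ) (f : 𝒳 ⟶ S) (g : 𝒳 ⟶ 𝒳) (s₁ s₀ : ComplexPoints S) (e : X.X ≅ fiberOver f s₁), IsSmoothProjectiveFamily f (2 * k) ∧ (∃ (N : ℕ) (ι : 𝒳 ⟶ projectiveSpace N ℂ ⊗ S), IsClosedImmersion ι.left ∧ ι ≫ snd (projectiveSpace N ℂ) S = f) ∧ IrreducibleSpace S.left ∧ AlgebraicGeometry.Smooth S.hom ∧ IsQuasiProjectiveOver S ∧ g ≫ f = f ∧ (∀ s : ComplexPoints S, ∃ (A'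 : AbelianVariety ℂ) (φ' : A' ⟶ A') (e' : A'.X ≅ fiberOver f s), A'.dim = 2 * k ∧ φ' ≫ φ' = -((p : ℤ) • 𝟙 A') ∧ (e'.hom ≫ fiberι f s) ≫ g = φ'.hom.hom.hom ≫ (e'.hom ≫ fiberι f s)) ∧ (e.hom ≫ fiberι f s₁) ≫ g = Φ.hom.hom.hom ≫ (e.hom ≫ fiberι f s₁) ∧ (∃ (ιb : Type) (_ : Fintype ιb) (_ : DecidableEq ιb) (b : Module.Basis ιb ℂ (complexBetti (fiberOver f s₁) 1)) (Jℤ : Matrix ιb ιb ℤ) (n' : ℕ), 3 ≤ n' ∧ (∀ g₁ : fiberOver f s₁ ⟶ fiberOver f s₁, g₁ ≫ fiberι f s₁ = fiberι f s₁ ≫ g → LinearMap.toMatrix b b (complexBetti.map g₁ 1).hom = Jℤ.map (Int.castRingHom ℂ)) ∧ ∀ (hU : IsCohomologicallyLocallyTrivialOn f (Set.univ : Set (ComplexPoints S))) (γ : Path.Homotopic.Quotient (⟨s₁, Set.mem_univ s₁⟩ : (Set.univ : Set (ComplexPoints S))) ⟨s₁, Set.mem_univ s₁⟩), ∃ Dℤ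 : Matrix ιb ιb ℤ, LinearMap.toMatrix b b (transportLinear f 1 hU γ :) = (1 + (n' : ℤ) • Dℤ).map (Int.castRingHom ℂ)) ∧ ∃ (Y : AbelianVariety ℂ) (Ψ : Y ⟶ Y) (e₀ : Y.X ≅ fiberOver f s₀) (hY : Y.dim = 2 * k), Ψ ≫ Ψ = -((p : ℤ) • 𝟙 Y) ∧ (e₀.hom ≫ fiberι f s₀) ≫ g = Ψ.hom.hom.hom ≫ (e₀.hom ≫ fiberι f s₀) ∧ ∃ Pr : complexBetti Y.X 1 →ₗ[ℂ] complexBetti Y.X 1, IsIdempotentElem Pr ∧ Pr ∘ₗ (complexBetti.map Ψ.hom.hom.hom 1).hom = (complexBetti.map Ψ.hom.hom.hom 1).hom ∘ₗ Pr ∧ (∀ x, IsRationalClass x → IsRationalClass (Pr x)) ∧ LinearMap.range Pr ⊓ Module.End.eigenspace (complexBetti.map Ψ.hom.hom.hom 1).hom (Complex.I * (Real.sqrt p : ℂ)) ≤ hodgeZeroOne (Motives.isSmoothProjective_of_dim_eq' hY) ∧ LinearMap.ker Pr ⊓ Module.End.eigenspace (complexBetti.map Ψ.hom.hom.hom 1).hom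 (Complex.I * (Real.sqrt p : ℂ)) ≤ hodgeOneZero (Motives.isSmoothProjective_of_dim_eq' hY)) := by
  intro h p hp hp4 hp7 k hk X Φ hX hΦ hbal
  have hp0 : 0 < p := hp.pos
  have hΦn : Φ ≫ Φ = -(p • 𝟙 X) := by rw [hΦ, natCast_zsmul]
  -- `(X, Φ)` is of Weil type `(k, p)`: the balancedness hypothesis of [U_alg] IS van Geemen 4.9
  have hWT : IsWeilType X Φ k p := ⟨hk, hp0, hX, hΦn, hbal⟩
  -- a projective embedding of `X` and a non-zero rational class on its projective space
  have hXsp : IsSmoothProjective (2 * k) X.X := Motives.isSmoothProjective_of_dim_eq' hX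
  let eX : ProjectiveEmbedding X.X := hXsp.isProjectiveOver.projectiveEmbedding
  have hNX : 1 ≤ eX.n := le_trans (by omega) (le_of_isClosedImmersion_projectiveSpace hXsp eX.ι)
  obtain ⟨a, ha, ha0⟩ := exists_isRationalClass_ne_zero_projectiveSpace hNX
  -- the period construction through `X` — asked AT A WEIL-TYPE POINT only
  obtain ⟨𝒳, S, f, g, s₁, e, Yf, Ψf, ε, N, ι, -, hfam, hιci, hιf, hirr, hsm, hSqp, hg, he, hfib, hlev, hU, -, -⟩ :=
    h k p hk hp0 X Φ eX a hX hΦ ha ha0 hWT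
  obtain ⟨m, hm, hXm, hd, hΦ', ω, hω, hω0, hsurj⟩ := hU
  set D := weilDatumOfKsymm hm hXm hd hΦ' eX ha ha0 hω hω0 with hD
  haveI : FiniteDimensional ℚ (bettiCohomology X.X 1) := finite_bettiCohomology_one X
  have hV : Module.finrank ℚ (bettiCohomology X.X 1) = 4 * k := by rw [finrank_bettiCohomology_one, hX]; ring
  -- the rational point `J_R` of `X⁺(D)` and the fibre `Y = Y_{s₀}` over it
  obtain ⟨P, Nn, R, hRα, hPα, hNα, hcpl, -, -, -, -, -, -, -, -, hW, hEP, hEN, -, -⟩ :=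
    D.exists_isWeilComplexStructure_rational
  obtain ⟨s₀, β, hβK, hβH⟩ := hsurj _ hW
  obtain ⟨hY₀, hΨ₀, hε₀⟩ := hfib s₀
  have hβH' : ∀ x ∈ HodgeStructure.cxF1 (D.realJ ((D.c : ℂ) • D.cxMap R hRα)),
      IsOfHodgeType (2 * k) (Yf s₀).X 1 1 0
        (Motives.ofRatClassBaseChange (ComplexPoints (Yf s₀).X) 1 (β.toLinearMap.baseChange ℂ x)) :=
    fun x hx => hβH x (by rwa [WeilDatum.piece_one_zero_hodgeStructure])
  have hβK' : ∀ x, β (D.α x) = bettiCohomology.map (Ψf s₀).hom.hom.hom 1 (β x) := fun x => hβK x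
  -- the CM projector at `Y_{s₀}`
  set μ : ℂ := Complex.I * (Real.sqrt p : ℂ) with hμ
  have hι : D.iSqrt = μ := by
    rw [hμ, WeilDatum.iSqrt, hD, weilDatumOfKsymm_d, Rat.cast_natCast]
  obtain ⟨Pr, hPr, hPrT, hPrrat, hrange, hker⟩ :=
    cm_projector_of_periodPoint hY₀ hV D hRα hPα hNα hcpl hW.sq hEP hEN β (Ψf s₀) hβK' hβH'
  rw [hι] at hrange hker
  -- assemble [U_alg]
  exact ⟨𝒳, S, f, g, s₁, s₀, e, hfam, ⟨N, ι, hιci, hιf⟩, hirr, hsm, hSqp, hg,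
    fun t => ⟨Yf t, Ψf t, ε t, (hfib t).1, (hfib t).2.1, (hfib t).2.2⟩, he, hlev,
    Yf s₀, Ψf s₀, ε s₀, hY₀, hΨ₀, hε₀, Pr, hPr, hPrT, hPrrat, hrange, hker⟩

/-- **`HeckePrymAnchors` from Deligne's period construction AT WEIL-TYPE POINTS** — the crux of line
`Sketch` from the PRINTED scope of [Deligne1982HodgeCycles], proof of Thm. 4.8: the level-`n'` algebraic
family `Γ∖B → Γ∖X⁺` with period surjectivity, asked only through abelian varieties OF WEIL TYPE `(n, n)`
(Prop. 4.4 — the signature forced by Thm. 4.8's hypothesis (b), a SPLIT `E`-Hermitian form carrying a Riemann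
form; the family is built from the signature-`(n, n)` data alone; van Geemen 5.3–5.5, 5.8–5.11 for every
discriminant), implies
`HeckePrymAnchors`, by `cmAnchoredFamily_of_periodConstructionAtWeilType` and the landed
`heckePrymAnchors_of_cmAnchoredFamily`. Compared with the landed `heckePrymAnchors_of_periodConstruction`
the hypothesis has a WEAKER PREMISE (asked only at Weil-type points, `IsWeilType`) and a STRONGER CONCLUSION
(the extra polarization datum `a'` with clause (6), which this proof discards): the two packages are
INCOMPARABLE as typed, and only the [U]-part at Weil-type points is consumed. It IS the restriction to
Weil-type points of the package `h` of `Literature.AlgebraicGeometry.HodgeTheory.weilFamilies_of_periodConstruction`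
(and of `weilFamilies_of_periodConstruction_only`), which keeps clause (6), and it is token-for-token
(whitespace-normalised) the body of the cell `pub-hsemireg`'s named-fact candidate
`deligne1982_weilFamily_periodConstructionAtWeilType`.
Nothing here proves any case of the Hodge conjecture; the package is an UNPROVED hypothesis, displayed verbatim.
[cite: Deligne1982HodgeCycles, §4 Prop. 4.4, Lemma 4.5 and proof of Thm. 4.8 (Milne's TeXed ed., rev. 2018, pp. 32–34; LNM 900 §4)]
[cite: vanGeemen1994HodgeAV, 4.9, 5.3–5.5 and 5.8–5.11] [cite: MumfordFogartyKirwan1994, Thm. 7.9–7.10] -/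
theorem heckePrymAnchors_of_periodConstructionAtWeilType :
    (∀ (n d : ℕ), 1 ≤ n → 1 ≤ d →
        ∀ (P : AbelianVariety ℂ) (ψ₀ : P ⟶ P) (e : ProjectiveEmbedding P.X)
          (a : complexBetti (projectiveSpace e.n ℂ) 2),
          P.dim = 2 * n → ψ₀ ≫ ψ₀ = -((d : ℤ) • 𝟙 P) → ∀ (ha : IsRationalClass a) (ha0 : a ≠ 0),
          IsWeilType P ψ₀ n d →
          ∃ (𝒳 S : SchemeOver ℂ) (f : 𝒳 ⟶ S) (g : 𝒳 ⟶ 𝒳) (s₀ : ComplexPoints S)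
            (e' : P.X ≅ fiberOver f s₀)
            (Y : ComplexPoints S → AbelianVariety ℂ) (Ψ : ∀ s, Y s ⟶ Y s)
            (ε : ∀ s, (Y s).X ≅ fiberOver f s) (N : ℕ)
            (ι : 𝒳 ⟶ CategoryTheory.MonoidalCategoryStruct.tensorObj (projectiveSpace N ℂ) S)
            (a' : complexBetti (projectiveSpace N ℂ) 2),
            IsSmoothProjectiveFamily f (2 * n) ∧
            AlgebraicGeometry.IsClosedImmersion ι.left ∧
            ι ≫ CategoryTheory.CartesianMonoidalCategory.snd (projectiveSpace N ℂ) S = f ∧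
            IrreducibleSpace S.left ∧ AlgebraicGeometry.Smooth S.hom ∧ IsQuasiProjectiveOver S ∧
            g ≫ f = f ∧
            (e'.hom ≫ fiberι f s₀) ≫ g = ψ₀.hom.hom.hom ≫ (e'.hom ≫ fiberι f s₀) ∧
            (∀ s, (Y s).dim = 2 * n ∧ Ψ s ≫ Ψ s = -((d : ℤ) • 𝟙 (Y s)) ∧
              ((ε s).hom ≫ fiberι f s) ≫ g = (Ψ s).hom.hom.hom ≫ ((ε s).hom ≫ fiberι f s)) ∧
            (∃ (ιb : Type) (_ : Fintype ιb) (_ : DecidableEq ιb)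
                (b : Module.Basis ιb ℂ (complexBetti (fiberOver f s₀) 1)) (Jℤ : Matrix ιb ιb ℤ)
                (n' : ℕ),
              3 ≤ n' ∧
              (∀ g₀ : fiberOver f s₀ ⟶ fiberOver f s₀, g₀ ≫ fiberι f s₀ = fiberι f s₀ ≫ g →
                LinearMap.toMatrix b b (complexBetti.map g₀ 1).hom = Jℤ.map (Int.castRingHom ℂ)) ∧
              ∀ (hU : IsCohomologicallyLocallyTrivialOn f (Set.univ : Set (ComplexPoints S)))
                (γ : Path.Homotopic.Quotient
                  (⟨s₀, Set.mem_univ s₀⟩ : (Set.univ : Set (ComplexPoints S))) ⟨s₀, Set.mem_univ s₀⟩),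
                ∃ Dℤ : Matrix ιb ιb ℤ,
                  LinearMap.toMatrix b b (transportLinear f 1 hU γ :) =
                    (1 + (n' : ℤ) • Dℤ).map (Int.castRingHom ℂ)) ∧
            (∃ (m : ℕ) (hm : 1 ≤ m) (hPm : P.dim = m + 1) (hd : 0 < d) (hψ : ψ₀ ≫ ψ₀ = -(d • 𝟙 P))
                (ω : complexBetti P.X (2 + 2 * m)) (hω : IsRationalClass ω) (hω0 : ω ≠ 0),
              ∀ (J : (weilDatumOfKsymm hm hPm hd hψ e ha ha0 hω hω0).Cx →ₗ[ℂ]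
                  (weilDatumOfKsymm hm hPm hd hψ e ha ha0 hω hω0).Cx)
                (hW : Motives.IsWeilComplexStructure
                  (weilDatumOfKsymm hm hPm hd hψ e ha ha0 hω hω0).hForm J),
                ∃ (s : ComplexPoints S) (β : bettiCohomology P.X 1 ≃ₗ[ℚ] bettiCohomology (Y s).X 1),
                  (∀ x, β (bettiCohomology.map ψ₀.hom.hom.hom 1 x) =
                    bettiCohomology.map (Ψ s).hom.hom.hom 1 (β x)) ∧
                  ∀ x ∈ ((weilDatumOfKsymm hm hPm hd hψ e ha ha0 hω hω0).hodgeStructure J hW.sq).piece 1 0,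
                    IsOfHodgeType (2 * n) (Y s).X 1 1 0
                      (Motives.ofRatClassBaseChange (ComplexPoints (Y s).X) 1
                        (β.toLinearMap.baseChange ℂ x))) ∧
            IsRationalClass a' ∧
            complexBetti.map e'.hom 2 (complexBetti.map (fiberι f s₀) 2
              (complexBetti.map
                (ι ≫ CategoryTheory.CartesianMonoidalCategory.fst (projectiveSpace N ℂ) S) 2 a')) =
              (d : ℂ) • complexBetti.map e.ι 2 a +
                complexBetti.map ψ₀.hom.hom.hom 2 (complexBetti.map e.ι 2 a)) →
    Summit.HodgeConjecture.HodgeConjecture.Theses.HeckePrymWeil.HeckePrymAnchors :=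
  fun h => heckePrymAnchors_of_cmAnchoredFamily (cmAnchoredFamily_of_periodConstructionAtWeilType h)

/-- **`HeckePrymAnchors` from the NAMED fact `deligne1982_weilFamily_periodConstructionAtWeilType`** (rev. 2; the
by-name sequel of `heckePrymAnchors_of_periodConstructionAtWeilType`, whose displayed hypothesis IS that name's body):
the crux `HeckePrymAnchors` of route `HeckePrymWeil` (stmt-HodgeConjecture-14496) holds CONDITIONALLY on exactly ONE
named printed fact — Deligne's level-`n'` algebraic family `Γ∖B → Γ∖X⁺` with its global `√-d`, abelian fibre
charts, integral level structure, period surjectivity onto `X⁺` and one polarization class, through every polarized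
complex abelian `2n`-fold OF WEIL TYPE `(n, n)` ([Deligne1982HodgeCycles] proof of Thm. 4.8, pp. 32–34, the family
being built from the signature-`(n, n)` Hermitian data; van Geemen 5.3–5.5, 5.8–5.11 for every discriminant), typed
as `Literature.AlgebraicGeometry.HodgeTheory.deligne1982_weilFamily_periodConstructionAtWeilType` and UNPROVED in the
tree (no moduli of abelian varieties, no universal family, no Baily–Borel there). CONDITIONAL RESULT: nothing here
proves any case of the Hodge conjecture; HC / HC_CM / HC_AV are NOT proved.
[cite: Deligne1982HodgeCycles, §4 Prop. 4.4, Lemma 4.5 and proof of Thm. 4.8 (Milne's TeXed ed., rev. 2018, pp. 32–34; LNM 900 §4)]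
[cite: vanGeemen1994HodgeAV, 4.9, 5.3–5.5 and 5.8–5.11] -/
theorem heckePrymAnchors_of_deligne1982_weilFamily_periodConstructionAtWeilType
    (hJ1 : deligne1982_weilFamily_periodConstructionAtWeilType) :
    Summit.HodgeConjecture.HodgeConjecture.Theses.HeckePrymWeil.HeckePrymAnchors :=
  heckePrymAnchors_of_periodConstructionAtWeilType hJ1

end Summit.HodgeConjecture.HodgeConjecture.Theorems.HeckePrymWeilLine

end
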